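import Summits.ABC.ABC.Theorems.DefiniteXiDefiniteRTControlPrimeOfTakahashi
import Literature.NumberTheory.EllipticCurves.TakahashiDegreeFormulaCoprimeProofs
import HarnessLib

/-!
# STUB-IDEAS companion — `stub_takahashi` · ideator k3 · generation 24 (FAMILY 3: probe the extremes)

Crux `stmt-ABC-11338` (`Summit.ABC.ABC.Theses.DefiniteXi.DefiniteRTControlPrime`); registered stub
`theorem stub_takahashi : takahashi2001_thm_2_3_of_coprime` (reviewed cite-only NAMED FACT,
`TakahashiDegreeFormula.lean`).  No new mathematics and no `sorry`: this file types the two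
FAMILY-3 objects of the g24 sheet `STUB-IDEAS-stub_takahashi-3.md`:

* H24.1 `TakahashiUpperAtPivot` — the EXTREMAL CONSUMED FORM: the only instance of the fact the
  landed closer `definiteRTControlPrime_of_takahashi` (p839521) touches is the one-sided bound
  `δ ≤ ξ(M; r) · ord_r Δ_min` at a conductor-restricted-minimal datum
  (`…OfTakahashiGlue.lean`, `deg_le_of_optimalIsogenyAt`, the single call of
  `takahashi2001_thm_2_3_of_coprime.modularDegree_le_brandtXi_mul`), here as a `Prop`;
* H24.2 `upperAtPivot_of_fact` — the registered fact is one producer (PROVED, = tree corollary);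
* H24.3 `conclusion_iff_eq_of_tamagawa_one` — the extremal row `c_r = 1` of the typed conclusion
  reads `δ = ξ` on the nose (no `i, j` to fit): the convention pin exercised by the certified rows
  37a1/43a1/53a1/61a1/79a1/83a1/89a1/101a1/131a1 (kit j345570, all `ξ = δ = 2`);
* H24.4 `UpperLine` — the signature of the optional 1-stub re-cut `TakahashiUpperAtPivot → crux`
  (S-sized re-thread of four wrappers of `…OfTakahashiGlue/OfTakahashi`, for a stub-worker; stated,
  not proved here).

[cite: Takahashi2001, Thm. 2.3 (p. 79)]
-/

set_option linter.dupNamespace false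

namespace Summit.ABC.ABC.Cruxes.DefiniteRTControlPrime.StubIdeas3G24

open Literature.NumberTheory.EllipticCurves Literature.NumberTheory.EllipticCurves.ModularForms
open Literature.NumberTheory.Automorphic

/-- **H24.1 (typed; the weakest statement the landed chain consumes).** Takahashi's ONE-SIDED
bound in `brandtXi` form at a conductor-restricted-minimal datum: for `r` prime, `gcd(M, r) = 1`,
`W` of conductor `M r` and `P` of minimal degree among the data (level `M r`, same newform) of all
curves of conductor `M r`: `deg P ≤ ξ(M; r)(a(W)) · ord_r Δ_min(W)`.  Exactly the type of
`takahashi2001_thm_2_3_of_coprime.modularDegree_le_brandtXi_mul h` with `h` discharged; strictly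
weaker than the registered stub (drops `0 < i`, `i·j = c_r`, `i ∣ ξ`, the exact `δ·i = ξ·j`).
[cite: Takahashi2001, Thm. 2.3 (p. 79)] -/
def TakahashiUpperAtPivot : Prop :=
  ∀ (W : WeierstrassCurve ℚ) [W.IsElliptic] (M r : ℕ) [NeZero (M * r)],
    r.Prime → M.Coprime r → W.conductorNorm ℤ = M * r →
    ∀ P : ModularParametrizationData W (M * r),
      (∀ (W' : WeierstrassCurve ℚ) [W'.IsElliptic], W'.conductorNorm ℤ = M * r →
          ∀ P' : ModularParametrizationData W' (M * r),
            P'.f = P.f → P.modularDegree ≤ P'.modularDegree) →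
      P.modularDegree ≤
        brandtXi M r (fun n => W.LFunction n) * (W.minimalDiscriminantNorm ℤ).factorization r

/-- **H24.2 (PROVED, XS).** The registered fact produces H24.1 — this IS the tree corollary
`takahashi2001_thm_2_3_of_coprime.modularDegree_le_brandtXi_mul` (`…CoprimeProofs.lean:301`).
[cite: Takahashi2001, Thm. 2.3 (p. 79)] -/
theorem upperAtPivot_of_fact (h : takahashi2001_thm_2_3_of_coprime) : TakahashiUpperAtPivot :=
  fun W _ M r _ hr hcop hN P hmin =>
    takahashi2001_thm_2_3_of_coprime.modularDegree_le_brandtXi_mul h W M r hr hcop hN P hmin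

/-- **H24.3 (PROVED, XS; the extremal row).** At a prime of Tamagawa exponent one (`c_r = 1`) the
typed conclusion of the stub has no freedom left: it says `δ = ξ` exactly. [folklore] -/
theorem conclusion_iff_eq_of_tamagawa_one (δ ξ : ℕ) :
    (∃ i j : ℕ, 0 < i ∧ i * j = 1 ∧ i ∣ ξ ∧ δ * i = ξ * j) ↔ δ = ξ := by
  constructor
  · rintro ⟨i, j, -, hij, -, hδ⟩
    have hi : i = 1 := Nat.eq_one_of_mul_eq_one_right hij
    have hj : j = 1 := Nat.eq_one_of_mul_eq_one_left hij
    subst hi; subst hj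
    simpa using hδ
  · rintro rfl
    exact ⟨1, 1, Nat.one_pos, rfl, one_dvd _, rfl⟩

/-- **H24.3′ (PROVED, XS; the general row, k3-g22's square law restated for the record).** At fixed
numbers with `0 < δ` the typed conclusion is the single Diophantine condition
`∃ i > 0, i ∣ c ∧ i ∣ ξ ∧ δ·i² = ξ·c` — the shape a minimal counterexample must violate. [folklore] -/
theorem conclusion_iff_sq (δ c ξ : ℕ) :
    (∃ i j : ℕ, 0 < i ∧ i * j = c ∧ i ∣ ξ ∧ δ * i = ξ * j) ↔
      ∃ i : ℕ, 0 < i ∧ i ∣ c ∧ i ∣ ξ ∧ δ * i * i = ξ * c := by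
  constructor
  · rintro ⟨i, j, hi, hij, hiξ, hδ⟩
    refine ⟨i, hi, ⟨j, hij.symm⟩, hiξ, ?_⟩
    calc δ * i * i = ξ * j * i := by rw [hδ]
      _ = ξ * (i * j) := by ring
      _ = ξ * c := by rw [hij]
  · rintro ⟨i, hi, ⟨j, hj⟩, hiξ, hδ⟩
    refine ⟨i, j, hi, hj.symm, hiξ, ?_⟩
    have h : δ * i * i = ξ * j * i := by
      calc δ * i * i = ξ * c := hδ
        _ = ξ * (i * j) := by rw [hj]
        _ = ξ * j * i := by ring
    exact Nat.eq_of_mul_eq_mul_right hi h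

/-- **H24.4 (signature only; S for a stub-worker).** The optional ONE-stub re-cut: the crux BY NAME
from H24.1.  Proof recipe (not executed here): copy `deg_le_of_optimalIsogenyAt`,
`definiteRTControlPrime_of_optimalRadiusSubpoly`, `definiteRTControlPrime_of_freyIsogenyRadiusSubpoly`
and `definiteRTControlPrime_of_takahashi` from `…OfTakahashiGlue.lean` / `…OfTakahashi.lean` with the
binder `(hT : takahashi2001_thm_2_3_of_coprime)` replaced by `(hU : TakahashiUpperAtPivot)` and the
single call `…modularDegree_le_brandtXi_mul hT Ws M q hq hcop hNs Ps hPsmin` replaced by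
`hU Ws M q hq hcop hNs Ps hPsmin`; nothing else in the chain mentions `hT`. [folklore] -/
def UpperLine : Prop :=
  TakahashiUpperAtPivot → Summit.ABC.ABC.Theses.DefiniteXi.DefiniteRTControlPrime

/-- Sanity (XS): the registered one-stub composition still resolves at HEAD — the crux BY NAME
from the fact (Lines/Takahashi.lean's `DefiniteRTControlPrime_of`). -/
example : takahashi2001_thm_2_3_of_coprime →
    Summit.ABC.ABC.Theses.DefiniteXi.DefiniteRTControlPrime :=
  Summit.ABC.ABC.Theorems.DefiniteRTControlPrime.definiteRTControlPrime_of_takahashi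

/-- Sanity (XS): `UpperLine` and the fact together give the crux (so registering the re-cut loses
nothing: the fact remains a sufficient producer through H24.2). -/
theorem crux_of_upperLine_of_fact (hL : UpperLine) (h : takahashi2001_thm_2_3_of_coprime) :
    Summit.ABC.ABC.Theses.DefiniteXi.DefiniteRTControlPrime :=
  hL (upperAtPivot_of_fact h)

end Summit.ABC.ABC.Cruxes.DefiniteRTControlPrime.StubIdeas3G24
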